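import Literature.Probability.RandomPlanarGeometry.ConformalRestrictionProofs
import Literature.Probability.RandomPlanarGeometry.SLEUniquenessInLaw
import Literature.Probability.RandomPlanarGeometry.CaratheodoryHalfPlaneProofs
import HarnessLib

/-!
# Conformal covariance of the chordal SLE_κ laws between Dobrushin domains, discharged

Proof-only leaf file for the named fact
`Literature.Probability.RandomPlanarGeometry.IsSLELaw.conformalCovariance`
(`ConformalRestrictionProofs.lean`): if `μ` is a chordal SLE_κ law in `(D; a, b)`, `μ'` one in
`(D'; a', b')`, `g : D → D'` is a conformal equivalence with boundary values `a ↦ a'`, `b ↦ b'`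
and `Φ : ℂ → ℂ` is continuous and agrees with `g` on `D`, then `μ' = Φ_* μ`.

Source. G. F. Lawler, *Conformally Invariant Processes in the Plane*, AMS Math. Surveys and
Monographs **114** (2005): §6.1, p. 149, last paragraph — "Let `D` be a simply connected domain
and `z, w` distinct points on `∂D`. Let `F : D → ℍ` be a conformal transformation with
`F(z) = 0`, `F(w) = ∞`. The map `F` is not unique; however, any other such transformation `F̂`
can be written as `rF` for some `r > 0`. We define chordal SLE_κ in `D` to be the collection of
maps `h_t(z) = F⁻¹[g_t(F(z))]` … Hence the definition is independent of the choice of map up to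
a time change. … If `γ` is the SLE_κ path, then `F⁻¹ ∘ γ` gives the SLE_κ path in `D`. We
consider this as a measure on unparametrized paths." — restated in §6.3, p. 153: "`γ(t)` is an
SLE_κ connecting boundary points `z` and `w` in a domain `D` if it is the image of a time change
of chordal SLE_κ in `ℍ` connecting `0` and `∞`." Covariance between two domains is the
immediate consequence: if `φ : ℍ → D` is a chordal uniformizing map of `(D; a, b)` then `g ∘ φ`
is one of `(D'; a', b')`, so `Φ_* μ = (g ∘ φ)_*(SLE_κ in ℍ)` is an SLE_κ law in `D'`, equal to
`μ'` by the independence of the choice of map.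

The tree already contains this argument as
`IsSLELaw.conformalCovariance_of_facts (h₃ : IsSLECurve.map_eq) (h₅ : JordanDomain.exists_hasBoundaryValue)`
(`ConformalRestrictionProofs.lean`), and both inputs are by now theorems:
`IsSLECurve.map_eq_holds` (`SLEUniquenessInLaw.lean`: uniqueness in law of chordal SLE_κ in a
Dobrushin domain, Lawler §6.1 with SLE scaling Prop. 6.5) and
`JordanDomain.exists_hasBoundaryValue_holds` (`CaratheodoryHalfPlaneProofs.lean`: Carathéodory,
Pommerenke (1992) Thm. 2.1). This file only composes them; it is a separate leaf (rather than an
append to `ConformalRestrictionProofs.lean`) so that the 80 modules importing that file do not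
acquire the SLE-uniqueness and Carathéodory import cones.

Also recorded: the family-level corollary `ChordalFamily.isConformallyCovariant_of_isSLELaw`
(a chordal family all of whose laws are chordal SLE_κ laws is conformally covariant, for every
`κ`), which is the form the conformal-restriction assemblies consume.

## References

* G. F. Lawler, *Conformally Invariant Processes in the Plane*, AMS (2005), §6.1 p. 149 and
  §6.3 p. 153.
* Ch. Pommerenke, *Boundary Behaviour of Conformal Maps*, Springer (1992), Thm. 2.1.
-/

noncomputable section

open scoped NNReal

namespace Literature.Probability.RandomPlanarGeometry

/-- **Conformal covariance of the chordal SLE_κ laws between Dobrushin domains, proved.** If `μ`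
is a chordal SLE_κ law in `(D; a, b)`, `μ'` one in `(D'; a', b')`, `g : D → D'` is a conformal
equivalence with boundary values `a ↦ a'`, `b ↦ b'`, and `Φ : ℂ → ℂ` is continuous and agrees
with `g` on `D`, then `μ' = Φ_* μ`. Chordal SLE_κ in `D` is *defined* as the conformal image of
chordal SLE_κ in `(ℍ; 0, ∞)`, "independent of the choice of map up to a time change" (Lawler
(2005), §6.1 p. 149; restated §6.3 p. 153); composing a uniformizing map of `D` with `g` gives
one of `D'` (`IsSLECurve.map`, using Carathéodory's boundary values
`JordanDomain.exists_hasBoundaryValue_holds`), and the image law is then `μ'` by uniqueness in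
law (`IsSLECurve.map_eq_holds`). Discharges `IsSLELaw.conformalCovariance` via
`IsSLELaw.conformalCovariance_of_facts`.
[cite: Lawler2005, §6.1 p. 149 (definition of chordal SLE_κ in a domain) and §6.3 p. 153] -/
theorem IsSLELaw.conformalCovariance_holds : IsSLELaw.conformalCovariance :=
  IsSLELaw.conformalCovariance_of_facts IsSLECurve.map_eq_holds
    JordanDomain.exists_hasBoundaryValue_holds

/-- **A family of chordal SLE_κ laws is conformally covariant** (every `κ`, unconditionally): if
`Q D` is a chordal SLE_κ law in `(D; a, b)` for every Dobrushin domain `D`, then `Q` is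
conformally covariant in the sense of `ChordalFamily.IsConformallyCovariant`
(`Q D' = Φ_* (Q D)` for conformal `g : D → D'` respecting the marked points and `Φ` continuous
agreeing with `g` on `D`). Lawler (2005), §6.1 p. 149. [cite: Lawler2005, §6.1 p. 149] -/
theorem ChordalFamily.isConformallyCovariant_of_isSLELaw {κ : ℝ≥0} {Q : ChordalFamily}
    (hQ : ∀ D : DobrushinDomain, IsSLELaw κ D (Q D)) : Q.IsConformallyCovariant :=
  fun D D' g Φ h0 h1 hΦ ↦ IsSLELaw.conformalCovariance_holds D D' g Φ (hQ D) (hQ D') h0 h1 hΦ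

end Literature.Probability.RandomPlanarGeometry

end
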